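import Mathlib
import Summits.CriticalPhenomena.SAWScalingLimit.Theses.SAWDefectDecoherence
import Summits.CriticalPhenomena.SAWScalingLimit.Theorems.ObservableToSLE.Negative.Identification
import Summits.CriticalPhenomena.SAWScalingLimit.Theorems.SAWDefectDecoherenceObservableToSLERGateDecomposition
import Summits.CriticalPhenomena.SAWScalingLimit.Theorems.SAWDefectDecoherenceObservableToSLERNestedTransferProductCells
import Summits.CriticalPhenomena.SAWScalingLimit.Theorems.SAWDefectDecoherenceObservableToSLERGateTransferPerCell
import Summits.CriticalPhenomena.SAWScalingLimit.Theorems.SAWDefectDecoherenceObservableToSLERMidTightSubarc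

/-!
# Averaged tightness of the carved middle pieces (`HexTight → MidTightN`)

Stub `stub_midTightN` (stub 5b of reshape r5) of the line `bridge-gate-renewal` for the crux
`Summit.CriticalPhenomena.SAWScalingLimit.Theses.SAWDefectDecoherence.ObservableToSLER`
(item `stmt-CriticalPhenomena-14005`).  The line re-roots the critical hexagonal SAW at its first
good gates of tame nested families; the sequential reduction (stub 5c) consumes, besides the carved
sequential identification (stub 5a), the AVERAGED TIGHTNESS OF THE CARVED MIDDLE LAWS proved here:
for every `η > 0` there is a compact set `𝒦` of curve classes such that, for all small meshes and
ALL tame nested families, the walks whose first good gates carve a middle law putting mass `> η`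
outside `𝒦` have `hexSAWLaw`-mass `≤ η`.

Proof.  `HexTight` at level `η²` gives a compact `𝒦₀` with `P_δ(curve ∉ 𝒦₀) ≤ η²` eventually; the
helper file `…MidTightSubarc` gives a compact `𝒦` containing the class of the middle piece of
every polyline whose class lies in `𝒦₀` (sub-curves of a compact family are relatively compact:
Aizenman–Burchard).  At a mesh with product cells (`eventually_productCellN`, `R ≤ R₁`):
* `measure_midCurve_preimage_inter_cyl` — per-cell identity in mass form (from
  `map_midCurve_restrict_cyl` and `measure_cyl` under `GateDecomposition`, landed p82259):
  `W(cell ∩ {midCurve ∈ B}) = W(cell) · carvedLaw(curve ∈ B)`;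
* `measure_badCarved_mul_le` — Markov over the cells: the bad event is covered by the (disjoint)
  cells `κ` with `carvedLaw_κ(curve ∉ 𝒦) > c`, so
  `c · P(bad) ≤ Σ_κ P(cell κ) carvedLaw_κ(curve ∉ 𝒦) = P(⋃_κ cell κ ∩ {midCurve_κ ∉ 𝒦}) ≤ P(curve ∉ 𝒦₀)`
  (a walk of a cell whose whole polyline lies in `𝒦₀` has its middle polyline in `𝒦`);
* `stub_midTightN` — with `c = η`: `η · P(bad) ≤ η²`, hence `P(bad) ≤ η`.
-/

noncomputable section

open scoped BigOperators Topology NNReal ENNReal Classical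
open Filter Set MeasureTheory Metric

namespace Summit.CriticalPhenomena.SAWScalingLimit.Theorems.ObservableToSLER.NestedGate

open Literature.Probability.LatticeModels (HexVertex hexGraph hexCenter triZeta Site polyline)
open Literature.Probability.RandomPlanarGeometry
open Literature.Probability.RandomPlanarGeometry.SAW
open Summit.CriticalPhenomena.SAWScalingLimit.Theorems.ObservableToSLE.Negative
  (finite_hexDomainSAW)
open Summit.CriticalPhenomena.SAWScalingLimit.Theorems.ObservableToSLER.BridgeGate
open Summit.CriticalPhenomena.SAWScalingLimit.Theses.SAWDefectDecoherence (HexTight)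

section PerCell

variable {Ω : Set ℂ} {δ : ℝ} {a b : HexVertex}

/-- **Per-cell identity, mass form, for an event of the middle curve**: on a cylinder, the critical
weight of the walks whose middle curve lies in `B` is the weight of the cylinder times the
carved-law probability that the curve lies in `B` (`map_midCurve_restrict_cyl`, `measure_cyl`). -/
theorem measure_midCurve_preimage_inter_cyl (κ : GateLabel) (S T : Set HexVertex)
    [Finite (HexDomainSAW Ω δ κ.q κ.q')]
    (hGD : ∀ B : Set (List HexVertex),
      hexSAWWeight Ω δ a b
          {γ | ∃ mid ∈ B, mid.head? = some κ.q ∧ mid.getLast? = some κ.q' ∧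
            (∀ v ∈ mid, v ∉ S ∧ v ∉ T) ∧ γ.walk.support = κ.l₁ ++ mid ++ κ.l₂} =
        ENNReal.ofReal (hexCriticalFugacity ^ (κ.l₁.length + κ.l₂.length)) *
          hexSAWWeight Ω δ κ.q κ.q'
            {γ | γ.walk.support ∈ B ∧ ∀ v ∈ γ.walk.support, v ∉ S ∧ v ∉ T})
    {B : Set (CurveClass ℂ)} (hB : MeasurableSet B) :
    hexSAWWeight Ω δ a b (κ.midCurve δ ⁻¹' B ∩ κ.cyl S T Ω δ a b) =
      hexSAWWeight Ω δ a b (κ.cyl S T Ω δ a b) *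
        carvedLaw Ω δ (S ∪ T) κ.q κ.q' ((fun ξ => ξ.curve) ⁻¹' B) := by
  have h := congrArg (fun μ : Measure (CurveClass ℂ) => μ B) (map_midCurve_restrict_cyl κ S T hGD)
  simp only [Measure.map_apply (EmbDomainSAW.measurable_of_top _) hB,
    Measure.restrict_apply (MeasurableSpace.measurableSet_top), Measure.smul_apply,
    smul_eq_mul] at h
  rw [h, measure_cyl κ S T hGD, carvedLaw, Measure.smul_apply, smul_eq_mul]
  have hfin : carvedWeight Ω δ (S ∪ T) κ.q κ.q' Set.univ ≠ ∞ := by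
    rw [carvedWeight]
    exact ne_top_of_le_ne_top (hexSAWWeight_ne_top Set.univ) (Measure.restrict_le_self _)
  rcases eq_or_ne (carvedWeight Ω δ (S ∪ T) κ.q κ.q' Set.univ) 0 with h0 | h0
  · have hB0 : carvedWeight Ω δ (S ∪ T) κ.q κ.q' ((fun ξ => ξ.curve) ⁻¹' B) = 0 :=
      measure_mono_null (Set.subset_univ _) h0
    rw [hB0, h0]
    simp
  · rw [mul_assoc, ← mul_assoc (carvedWeight Ω δ (S ∪ T) κ.q κ.q' Set.univ),
      ENNReal.mul_inv_cancel h0 hfin, one_mul]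

end PerCell

section PerMesh

variable {Ω : Set ℂ} {δ ρ R : ℝ} {S T : ℕ → Set HexVertex} {a b : HexVertex}

/-- **THE PER-MESH MARKOV ESTIMATE OVER THE CELLS.**  At a mesh where every critical SAW lies in a
product cell over the families `S`, `T` (and `GateDecomposition` holds), for a measurable set `𝒦`
of curve classes containing the class of the middle piece of every lattice polyline whose class
lies in `𝒦₀`, and every level `c`: `c` times the `hexSAWLaw`-mass of the walks whose first good
gates carve a middle law putting mass `> c` outside `𝒦` is at most the `hexSAWLaw`-mass of the
walks whose own curve lies outside `𝒦₀`. -/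
theorem measure_badCarved_mul_le (hΩ : Bornology.IsBounded Ω) (hδ : 0 < δ) {C : ℝ}
    (hGD : ∀ (p q p' q' : HexVertex) (S T : Set HexVertex) (l₁ l₂ : List HexVertex)
      (B : Set (List HexVertex)),
      Disjoint S T →
      (∃ w₁ : (hexDomainGraph Ω δ).Walk a p, w₁.IsPath ∧ w₁.support = l₁ ∧ ∀ v ∈ l₁, v ∈ S) →
      (∃ w₂ : (hexDomainGraph Ω δ).Walk p' b, w₂.IsPath ∧ w₂.support = l₂ ∧ ∀ v ∈ l₂, v ∈ T) →
      (hexDomainGraph Ω δ).Adj p q → (hexDomainGraph Ω δ).Adj q' p' →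
      hexSAWWeight Ω δ a b
          {γ | ∃ mid ∈ B, mid.head? = some q ∧ mid.getLast? = some q' ∧
            (∀ v ∈ mid, v ∉ S ∧ v ∉ T) ∧ γ.walk.support = l₁ ++ mid ++ l₂} =
        ENNReal.ofReal (hexCriticalFugacity ^ (l₁.length + l₂.length)) *
          hexSAWWeight Ω δ q q'
            {γ | γ.walk.support ∈ B ∧ ∀ v ∈ γ.walk.support, v ∉ S ∧ v ∉ T})
    (hcs : ∀ γ₀ : HexDomainSAW Ω δ a b, γ₀ ∈ productCellN Ω δ ρ R S T a b C)
    {𝒦₀ 𝒦 : Set (CurveClass ℂ)} (h𝒦 : MeasurableSet 𝒦)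
    (hsub : ∀ l₁ mid l₂ : List HexVertex,
      polyClass δ (l₁ ++ mid ++ l₂) ∈ 𝒦₀ → polyClass δ mid ∈ 𝒦)
    (c : ℝ≥0∞) :
    hexSAWLaw Ω δ a b
        {γ | ∃ (n m : ℕ) (p q : HexVertex) (n' m' : ℕ) (p' q' : HexVertex),
          IsFirstGoodGateN Ω δ ρ R S a γ.walk.support n m p q ∧
          IsFirstGoodGateN Ω δ ρ R T b γ.walk.support.reverse n' m' p' q' ∧
          c < carvedLaw Ω δ (S n ∪ T n') q q' {ξ | ξ.curve ∉ 𝒦}} * c ≤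
      hexSAWLaw Ω δ a b {γ | γ.curve ∉ 𝒦₀} := by
  classical
  haveI hfinT : ∀ u v : HexVertex, Finite (HexDomainSAW Ω δ u v) :=
    fun u v => finite_hexDomainSAW hΩ hδ.ne' u v
  haveI := Fintype.ofFinite (HexDomainSAW Ω δ a b)
  set W := hexSAWWeight Ω δ a b with hW
  set Bad : Set (HexDomainSAW Ω δ a b) :=
    {γ | ∃ (n m : ℕ) (p q : HexVertex) (n' m' : ℕ) (p' q' : HexVertex),
      IsFirstGoodGateN Ω δ ρ R S a γ.walk.support n m p q ∧
      IsFirstGoodGateN Ω δ ρ R T b γ.walk.support.reverse n' m' p' q' ∧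
      c < carvedLaw Ω δ (S n ∪ T n') q q' {ξ | ξ.curve ∉ 𝒦}} with hBad
  -- reduce to the un-normalised critical weight
  suffices hWc : W Bad * c ≤ W {γ | γ.curve ∉ 𝒦₀} by
    have hlaw : hexSAWLaw Ω δ a b = (W Set.univ)⁻¹ • W := rfl
    rw [hlaw, Measure.smul_apply, Measure.smul_apply, smul_eq_mul, smul_eq_mul, mul_assoc]
    exact mul_le_mul_right hWc _
  -- labels of the bad walks
  have hlab : ∀ γ : HexDomainSAW Ω δ a b, γ ∈ Bad → ∃ κ : GateLabel,
      γ.walk.support ∈ κ.cellN Ω δ ρ R S T a b ∧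
      c < carvedLaw Ω δ (S κ.n ∪ T κ.n') κ.q κ.q' {ξ | ξ.curve ∉ 𝒦} := by
    rintro γ ⟨n, m, p, q, n', m', p', q', h₁, h₂, hc⟩
    exact ⟨⟨n, m, p, q, n', m', p', q', γ.walk.support.take m,
      γ.walk.support.drop (γ.walk.support.length - m')⟩, ⟨h₁, h₂, rfl, rfl⟩, hc⟩
  let κ₀ : GateLabel := ⟨0, 0, a, a, 0, 0, a, a, [], []⟩
  let lab : HexDomainSAW Ω δ a b → GateLabel := fun γ =>
    if h : γ ∈ Bad then (hlab γ h).choose else κ₀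
  have hlab_spec : ∀ γ ∈ Bad, γ.walk.support ∈ (lab γ).cellN Ω δ ρ R S T a b ∧
      c < carvedLaw Ω δ (S (lab γ).n ∪ T (lab γ).n') (lab γ).q (lab γ).q' {ξ | ξ.curve ∉ 𝒦} := by
    intro γ h
    have hl : lab γ = (hlab γ h).choose := by simp only [lab, dif_pos h]
    rw [hl]
    exact (hlab γ h).choose_spec
  set Λ : Finset GateLabel := (Finset.univ.filter (· ∈ Bad)).image lab with hΛ
  set Cell : GateLabel → Set (HexDomainSAW Ω δ a b) :=
    fun κ => {γ | γ.walk.support ∈ κ.cellN Ω δ ρ R S T a b} with hCell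
  have hΛmem : ∀ κ ∈ Λ, ∃ γ ∈ Bad, lab γ = κ := by
    intro κ hκ
    simpa only [hΛ, Finset.mem_image, Finset.mem_filter, Finset.mem_univ, true_and] using hκ
  have hBadU : Bad ⊆ ⋃ κ ∈ Λ, Cell κ := by
    intro γ hγ
    refine Set.mem_iUnion₂.2 ⟨lab γ, ?_, (hlab_spec γ hγ).1⟩
    exact Finset.mem_image_of_mem _ (Finset.mem_filter.2 ⟨Finset.mem_univ _, hγ⟩)
  have hdisj : (Λ : Set GateLabel).PairwiseDisjoint Cell := by
    intro κ _ κ' _ hne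
    refine Set.disjoint_left.2 fun γ h h' => hne ?_
    exact GateLabel.eq_of_mem_cellN h h'
  have hdisjA : (Λ : Set GateLabel).PairwiseDisjoint fun κ => κ.midCurve δ ⁻¹' 𝒦ᶜ ∩ Cell κ :=
    hdisj.mono fun κ => Set.inter_subset_right
  have hmeas : ∀ s : Set (HexDomainSAW Ω δ a b), MeasurableSet s :=
    fun _ => MeasurableSpace.measurableSet_top
  -- per cell: `W (cell) * c ≤ W (cell ∩ {middle curve outside 𝒦})`
  have hper : ∀ κ ∈ Λ, W (Cell κ) * c ≤ W (κ.midCurve δ ⁻¹' 𝒦ᶜ ∩ Cell κ) := by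
    intro κ hκ
    obtain ⟨γ₀, hγ₀Bad, rfl⟩ := hΛmem κ hκ
    obtain ⟨hγ₀, hcκ⟩ := hlab_spec γ₀ hγ₀Bad
    set κ := lab γ₀ with hκdef
    obtain ⟨hST, hw₁, hw₂, hpq, hqp, -, -, -, -⟩ :=
      hcs γ₀ κ.n κ.m κ.p κ.q κ.n' κ.m' κ.p' κ.q' hγ₀.1 hγ₀.2.1
    have hcyl : Cell κ = κ.cyl (S κ.n) (T κ.n') Ω δ a b := by
      ext γ
      constructor
      · intro h
        have hlen := (hcs γ κ.n κ.m κ.p κ.q κ.n' κ.m' κ.p' κ.q' h.1 h.2.1).2.2.2.2.2.1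
        exact mem_cyl_of_mem_cellN h hlen
      · intro h
        exact mem_cellN_of_mem_cyl (hcs γ₀) hγ₀ h
    have hGDκ : ∀ B : Set (List HexVertex),
        hexSAWWeight Ω δ a b
          {γ | ∃ mid ∈ B, mid.head? = some κ.q ∧ mid.getLast? = some κ.q' ∧
            (∀ v ∈ mid, v ∉ S κ.n ∧ v ∉ T κ.n') ∧
            γ.walk.support = κ.l₁ ++ mid ++ κ.l₂} =
        ENNReal.ofReal (hexCriticalFugacity ^ (κ.l₁.length + κ.l₂.length)) *
          hexSAWWeight Ω δ κ.q κ.q'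
            {γ | γ.walk.support ∈ B ∧ ∀ v ∈ γ.walk.support, v ∉ S κ.n ∧ v ∉ T κ.n'} := by
      intro B
      rw [hγ₀.2.2.1] at hw₁
      rw [hγ₀.2.2.2] at hw₂
      exact hGD κ.p κ.q κ.p' κ.q' (S κ.n) (T κ.n') κ.l₁ κ.l₂ B hST hw₁ hw₂ hpq hqp
    rw [hcyl, measure_midCurve_preimage_inter_cyl (a := a) (b := b) κ (S κ.n) (T κ.n') hGDκ h𝒦.compl]
    exact mul_le_mul_right hcκ.le _
  -- the union of these events lies in the event "whole curve outside 𝒦₀"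
  have hAU : (⋃ κ ∈ Λ, κ.midCurve δ ⁻¹' 𝒦ᶜ ∩ Cell κ) ⊆ {γ | γ.curve ∉ 𝒦₀} := by
    intro γ hγ
    obtain ⟨κ, -, hmid, hcell⟩ := Set.mem_iUnion₂.1 hγ
    intro hcurve
    refine hmid ?_
    have hlen := (hcs γ κ.n κ.m κ.p κ.q κ.n' κ.m' κ.p' κ.q' hcell.1 hcell.2.1).2.2.2.2.2.1
    obtain ⟨mid, -, -, -, hsupp⟩ := mem_cyl_of_mem_cellN hcell hlen
    show κ.midCurve δ γ ∈ 𝒦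
    rw [GateLabel.midCurve, hsupp, midList_append]
    apply hsub κ.l₁ mid κ.l₂
    rw [← hsupp, ← curve_eq_polyClass]
    exact hcurve
  calc W Bad * c ≤ W (⋃ κ ∈ Λ, Cell κ) * c := mul_le_mul_left (measure_mono hBadU) _
    _ ≤ (∑ κ ∈ Λ, W (Cell κ)) * c := mul_le_mul_left (measure_biUnion_finset_le Λ Cell) _
    _ = ∑ κ ∈ Λ, W (Cell κ) * c := Finset.sum_mul _ _ _
    _ ≤ ∑ κ ∈ Λ, W (κ.midCurve δ ⁻¹' 𝒦ᶜ ∩ Cell κ) := Finset.sum_le_sum hper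
    _ = W (⋃ κ ∈ Λ, κ.midCurve δ ⁻¹' 𝒦ᶜ ∩ Cell κ) :=
        (measure_biUnion_finset hdisjA fun κ _ => hmeas _).symm
    _ ≤ W {γ | γ.curve ∉ 𝒦₀} := measure_mono hAU

end PerMesh

/-- **STUB 5b of the line `bridge-gate-renewal` (reshape r5) — `HexTight → MidTightN`, the
AVERAGED TIGHTNESS OF THE CARVED MIDDLE PIECES.**  For every `η > 0` there is a compact set `𝒦` of
curve classes such that for all small meshes and ALL tame nested families the walks whose first
good gates carve a middle law putting mass `> η` outside `𝒦` have `hexSAWLaw`-mass `≤ η`.  Proof: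
`R₂ := R₁` of `eventually_productCellN`; `HexTight` at level `η²` gives `𝒦₀`; `𝒦` is the compact
hull of the middle pieces of the polylines of `𝒦₀` (`MidTight.exists_isCompact_polyline_middle`);
per mesh, `measure_badCarved_mul_le` with `GateDecomposition` (`stub_gateDecomposition`, p82259)
gives `η · P(bad) ≤ P(curve ∉ 𝒦₀) ≤ η²`. -/
theorem stub_midTightN :
    HexTight →
    ∀ (D : DobrushinDomain) (a b : ℝ → HexVertex), IsEmbEndpointApprox hexGraph hexCenter D a b →
      ∃ R₂ > (0 : ℝ), ∀ R ∈ Set.Ioc (0 : ℝ) R₂, ∀ ρ > (0 : ℝ), ∀ N : ℕ, ∀ η > (0 : ℝ),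
        ∃ 𝒦 : Set (CurveClass ℂ), IsCompact 𝒦 ∧
          ∀ᶠ δ : ℝ in 𝓝[>] 0, ∀ S T : ℕ → Set HexVertex,
            TameNestedFamily δ R N (a δ) S → TameNestedFamily δ R N (b δ) T →
            hexSAWLaw D.carrier δ (a δ) (b δ)
              {γ | ∃ (n m : ℕ) (p q : HexVertex) (n' m' : ℕ) (p' q' : HexVertex),
                  IsFirstGoodGateN D.carrier δ ρ R S (a δ) γ.walk.support n m p q ∧
                  IsFirstGoodGateN D.carrier δ ρ R T (b δ) γ.walk.support.reverse n' m' p' q' ∧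
                  ENNReal.ofReal η <
                    carvedLaw D.carrier δ (S n ∪ T n') q q' {ξ | ξ.curve ∉ 𝒦}} ≤
              ENNReal.ofReal η := by
  intro hT D a b hab
  obtain ⟨R₁, hR₁, hcells⟩ := eventually_productCellN D a b hab
  refine ⟨R₁, hR₁, fun R hR ρ _ N η hη => ?_⟩
  -- tightness of the whole curves at level `η²`
  obtain ⟨𝒦₀, h𝒦₀, htight⟩ :=
    hT D a b hab (ENNReal.ofReal (η * η)) (ENNReal.ofReal_pos.2 (mul_pos hη hη))
  -- the compact hull of the middle pieces
  obtain ⟨𝒦, h𝒦, hmid⟩ := MidTight.exists_isCompact_polyline_middle (E := ℂ) h𝒦₀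
  refine ⟨𝒦, h𝒦, ?_⟩
  filter_upwards [hcells R hR ρ N, htight, self_mem_nhdsWithin] with δ hcs hKδ hδ
  intro S T hS hT'
  have hδ0 : 0 < δ := hδ
  have hsub : ∀ l₁ mid l₂ : List HexVertex,
      polyClass δ (l₁ ++ mid ++ l₂) ∈ 𝒦₀ → polyClass δ mid ∈ 𝒦 := by
    intro l₁ mid l₂ h
    have h' := hmid (l₁.map fun v => (δ : ℂ) * hexCenter v) (mid.map fun v => (δ : ℂ) * hexCenter v)
      (l₂.map fun v => (δ : ℂ) * hexCenter v)
    rw [← List.map_append, ← List.map_append] at h'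
    exact h' h
  have key := measure_badCarved_mul_le (ρ := ρ) (R := R) (S := S) (T := T) D.isBounded hδ0
    (stub_gateDecomposition D.carrier δ (a δ) (b δ)) (hcs S T hS hT') h𝒦.isClosed.measurableSet
    hsub (ENNReal.ofReal η)
  have hK' : hexSAWLaw D.carrier δ (a δ) (b δ) {γ | γ.curve ∉ 𝒦₀} ≤
      ENNReal.ofReal η * ENNReal.ofReal η := by
    rw [← ENNReal.ofReal_mul hη.le]
    exact hKδ
  have hη0 : ENNReal.ofReal η ≠ 0 := (ENNReal.ofReal_pos.2 hη).ne'
  exact (ENNReal.mul_le_mul_iff_left hη0 ENNReal.ofReal_ne_top).1 (key.trans hK')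

end Summit.CriticalPhenomena.SAWScalingLimit.Theorems.ObservableToSLER.NestedGate

end
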